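import Literature.NumberTheory.EllipticCurves.EisensteinValuesAtI
import Literature.Analysis.SpecialFunctions.LemniscateConstant

/-!
# `RealEllipticSectorKernel` (stmt-KontsevichZagierPeriods-10632), negative side: lemniscatic substitutions

Support lemmas for the cdisprove findings F9–F10: with `g(v) = 1/√(4v³ − 4v)` and
`h(w) = 1/√(4w − 4w³)`, the three real integrals `∫_(1,∞) g`, `∫_(0,1) h`, `∫_(−1,0) g` are all equal
to the lemniscatic half-period `Γ(1/4)²/(4√(2π))` (tree: `GaussianLattice.integral_Ioi_inv_sqrt_cubic_scaling`,
`integral_Ioi_one_inv_sqrt_cube_sub_self`), by the substitutions `w = 1/v` and `x = −w`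
(`MeasureTheory.integral_image_eq_integral_abs_deriv_smul`); integrability rides along
(`integrableOn_image_iff_integrableOn_abs_deriv_smul`). This is the VALUE form of the two-torsion
coincidence on `y² = 4x³ − 4x`, with no AGM and no `℘`.

Sources: M. Kontsevich, D. Zagier, *Periods* (2001), §1.1; Yu. V. Nesterenko, P. Philippon (eds.),
LNM 1752 (2001), Ch. 1 §3 (the lemniscatic integral). -/

noncomputable section

namespace Summit.KontsevichZagierPeriods.RealEllipticSectorKernel.CM66

open MeasureTheory Set

/-- half lemniscatic constant `Λ/2 = Γ(1/4)²/(4√(2π))`. [folklore] -/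
def lemHalf : ℝ := Real.Gamma (1 / 4) ^ 2 / (4 * Real.sqrt (2 * Real.pi))

/-- Auxiliary step of the isogeny / two-torsion computation (F9–F10). [folklore] -/
theorem lemHalf_pos : 0 < lemHalf := by
  unfold lemHalf
  have h1 : 0 < Real.Gamma (1 / 4) := Real.Gamma_pos_of_pos (by norm_num)
  have h2 : 0 < Real.sqrt (2 * Real.pi) := Real.sqrt_pos.mpr (by positivity)
  positivity

/-- `g(v) = 1/√(4v³ − 4v)` (the (4,0)-integrand). [folklore] -/
def gI (v : ℝ) : ℝ := (Real.sqrt (4 * v ^ 3 - 4 * v))⁻¹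

/-- `h(w) = 1/√(4w − 4w³)` (the (4,0)-twist integrand on (0,1)). [folklore] -/
def hI (w : ℝ) : ℝ := (Real.sqrt (4 * w - 4 * w ^ 3))⁻¹

/-- Auxiliary step of the isogeny / two-torsion computation (F9–F10). [folklore] -/
theorem integral_gI_Ioi : ∫ v in Ioi (1:ℝ), gI v = lemHalf := by
  have hsc := Literature.NumberTheory.EllipticCurves.GaussianLattice.integral_Ioi_inv_sqrt_cubic_scaling
    (e := 1) one_pos
  simp only [one_pow, mul_one, Real.sqrt_one] at hsc
  unfold gI lemHalf
  rw [hsc, Literature.Analysis.SpecialFunctions.integral_Ioi_one_inv_sqrt_cube_sub_self]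
  ring

/-- Auxiliary step of the isogeny / two-torsion computation (F9–F10). [folklore] -/
theorem integrableOn_gI_Ioi : IntegrableOn gI (Ioi (1:ℝ)) := by
  by_contra h
  have h0 := integral_undef h
  have := integral_gI_Ioi
  rw [h0] at this
  exact absurd this.symm (ne_of_gt lemHalf_pos)

/-- inversion `ρ v = v⁻¹` maps `(1,∞)` onto `(0,1)`. [folklore] -/
theorem image_inv_Ioi_one : (fun v : ℝ => v⁻¹) '' Ioi (1:ℝ) = Ioo 0 1 := by
  ext w
  simp only [mem_image, mem_Ioi, mem_Ioo]
  constructor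
  · rintro ⟨v, hv, rfl⟩
    exact ⟨by positivity, inv_lt_one_of_one_lt₀ hv⟩
  · rintro ⟨h0, h1⟩
    exact ⟨w⁻¹, one_lt_inv₀ h0 |>.mpr h1, inv_inv w⟩

/-- Auxiliary step of the isogeny / two-torsion computation (F9–F10). [folklore] -/
theorem hasDerivAt_inv' {v : ℝ} (hv : v ≠ 0) : HasDerivAt (fun v : ℝ => v⁻¹) (-(v ^ 2)⁻¹) v := by
  simpa using hasDerivAt_inv hv

/-- the pointwise weight identity for `ρ`. [folklore] -/
theorem inv_weight {v : ℝ} (hv : 1 < v) : |-(v ^ 2)⁻¹| • hI v⁻¹ = gI v := by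
  have hv0 : 0 < v := by linarith
  have hv2 : 0 < v ^ 2 := by positivity
  rw [abs_neg, abs_of_pos (inv_pos.mpr hv2), smul_eq_mul]
  unfold hI gI
  have hq : 4 * v⁻¹ - 4 * v⁻¹ ^ 3 = (4 * v ^ 3 - 4 * v) / (v ^ 2) ^ 2 := by
    field_simp
  rw [hq, Real.sqrt_div' _ (by positivity), Real.sqrt_sq hv2.le]
  have hpos : 0 < 4 * v ^ 3 - 4 * v := by nlinarith
  have hs : 0 < Real.sqrt (4 * v ^ 3 - 4 * v) := Real.sqrt_pos.mpr hpos
  field_simp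

/-- Auxiliary step of the isogeny / two-torsion computation (F9–F10). [folklore] -/
theorem integral_hI_Ioo : ∫ w in Ioo (0:ℝ) 1, hI w = lemHalf := by
  have key := integral_image_eq_integral_abs_deriv_smul (s := Ioi (1:ℝ)) (f := fun v : ℝ => v⁻¹)
    (f' := fun v => -(v ^ 2)⁻¹) measurableSet_Ioi
    (fun v hv => (hasDerivAt_inv' (by simp only [mem_Ioi] at hv; linarith)).hasDerivWithinAt)
    (fun a ha b hb hab => inv_injective hab) hI
  rw [image_inv_Ioi_one] at key
  rw [key, ← integral_gI_Ioi]
  refine setIntegral_congr_fun measurableSet_Ioi (fun v hv => ?_)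
  exact inv_weight hv

/-- Auxiliary step of the isogeny / two-torsion computation (F9–F10). [folklore] -/
theorem integrableOn_hI_Ioo : IntegrableOn hI (Ioo (0:ℝ) 1) := by
  have key := integrableOn_image_iff_integrableOn_abs_deriv_smul (s := Ioi (1:ℝ)) (f := fun v : ℝ => v⁻¹)
    (f' := fun v => -(v ^ 2)⁻¹) measurableSet_Ioi
    (fun v hv => (hasDerivAt_inv' (by simp only [mem_Ioi] at hv; linarith)).hasDerivWithinAt)
    (fun a ha b hb hab => inv_injective hab) hI
  rw [image_inv_Ioi_one] at key
  rw [key]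
  exact integrableOn_gI_Ioi.congr_fun (fun v hv => (inv_weight hv).symm) measurableSet_Ioi

/-- reflection: `∫_{(-1,0)} dx/√(4x³−4x) = ∫_{(0,1)} dw/√(4w−4w³)`. [folklore] -/
theorem integral_gI_Ioo_neg : ∫ x in Ioo (-1:ℝ) 0, gI x = lemHalf := by
  have key := integral_image_eq_integral_abs_deriv_smul (s := Ioo (0:ℝ) 1) (f := fun w : ℝ => -w)
    (f' := fun _ => -1) measurableSet_Ioo
    (fun w _ => (hasDerivAt_neg w).hasDerivWithinAt) (fun a _ b _ hab => neg_injective hab) gI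
  have himg : (fun w : ℝ => -w) '' Ioo (0:ℝ) 1 = Ioo (-1) 0 := by
    simp
  rw [himg] at key
  rw [key, ← integral_hI_Ioo]
  refine setIntegral_congr_fun measurableSet_Ioo (fun w hw => ?_)
  simp only [abs_neg, abs_one, one_smul, gI, hI]
  congr 1
  congr 1
  ring

end Summit.KontsevichZagierPeriods.RealEllipticSectorKernel.CM66

end
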